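import Literature.NumberTheory.Sieve.BatemanHornLinearProofs
import Literature.NumberTheory.Sieve.BatemanHornProofs
import Literature.NumberTheory.Sieve.ParityBatemanHorn
import Literature.NumberTheory.Sieve.HardyLittlewoodProofs
import HarnessLib

/-!
# SoloInformedPrimeTuples — the prime `k`-tuples conjecture is the monic-linear slice of the conjunct

Solo unit `solo-Parity-informed` (ideation tier, informed mode), session 147; `PLAN.md` §112,
CLAIMS C301.  Statement-audit value for the summit conjunct
`Summit.Parity.BatemanHorn := Literature.NumberTheory.Sieve.BatemanHornConjecture`.

For a finite tuple `H ⊆ ℤ` consider the linear system `f_H = (X + h)_{h ∈ H}` (indexed by the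
subtype `↥H`).  With the tree's exact normalisations we prove:

* `isBatemanHornSystem_linear_iff` — `f_H` satisfies the Bateman–Horn hypotheses iff `H` is
  admissible (`X + h` is irreducible, monic, two of them are associated iff equal, and
  `ω_{f_H}(p) = ν_H(p)` by the tree's `polyRootCountMod_linear_eq_tupleResidueCount_holds`);
* `batemanHornPartial_linear_eq_singularSeriesPartial`, `batemanHornConst_linear_eq_singularSeries`
  — the Bateman–Horn partial products of `f_H` *are* the partial products of the Hardy–Littlewood
  singular series, so `C(f_H) = 𝔖(H)` on the nose (both are `limUnder` of the same sequence);
* `polyPrimeCount_linear_eq` — `P_{f_H}(x) = π_H(x) + [every h ∈ H is a positive prime]`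
  (the Bateman–Horn count runs over `0 ≤ n ≤ x`, the tuple count over `1 ≤ n ≤ x`);
* `batemanHornAsymptotic_linear_iff` — for admissible `H`,
  `BatemanHornAsymptotic f_H ↔ π_H(x) ~ 𝔖(H) x/(log x)^{#H}` (the `O(1)` discrepancy is `o` of
  the main term, which tends to `∞` since `𝔖(H) = C(f_H) > 0`);
* `hardyLittlewoodTuples_iff_batemanHorn_linear` — the tree's registered open statement
  `HardyLittlewoodTuples` (parity.S01, Hardy–Littlewood's Conjecture X) is *literally* the
  conjunct restricted to the systems `f_H`; hence
* `hardyLittlewoodTuples_of_batemanHornConjecture`,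
  `hardyLittlewoodTuplesLi_of_batemanHornConjecture` — the conjunct implies the prime `k`-tuples
  conjecture in both of the tree's forms (`x/(log x)^k` and `Li_k`).

So the conjunct is at least as strong as every instance of the prime `k`-tuples conjecture, with
matching constants; the converse fails only in that the conjunct also covers non-linear systems
(`n² + 1`, …), cf. `Literature.StrongHypotheses.Parity`.

References: Bateman–Horn, Math. Comp. 16 (1962) 363–367, §3 (the linear case recovers
Hardy–Littlewood); Hardy–Littlewood, Acta Math. 44 (1923), Conjecture B / Theorem X 1;
Halberstam–Richert, *Sieve Methods*, ch. 10.
-/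

namespace Summit.Parity.BatemanHorn.Theorems

open Finset Filter Asymptotics Polynomial
open scoped Topology
open Literature.NumberTheory.Sieve

section LinearSlice

/-! ### The linear system `(X + h)_{h ∈ H}` of a finite tuple -/

/-- The linear system `(X + h)_{h ∈ H}` satisfies the Bateman–Horn hypotheses iff `H` is
admissible: each `X + h` is irreducible and monic, `X + h` and `X + h'` are associated only if
`h = h'`, and "no fixed prime divisor" is admissibility
(`hasNoFixedPrimeDivisor_linear_iff_holds`). Bateman–Horn 1962, §3. -/
theorem isBatemanHornSystem_linear_iff (H : Finset ℤ) :
    IsBatemanHornSystem (fun h : H ↦ (X + C (h : ℤ) : ℤ[X])) ↔ IsAdmissibleTuple H := by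
  refine ⟨fun hf ↦ (hasNoFixedPrimeDivisor_linear_iff_holds H).mp hf.hasNoFixedPrimeDivisor,
    fun hH ↦ ⟨fun h ↦ ?_, fun h ↦ ?_, ?_, (hasNoFixedPrimeDivisor_linear_iff_holds H).mpr hH⟩⟩
  · exact (monic_X_add_C (h : ℤ)).irreducible_of_degree_eq_one (degree_X_add_C _)
  · show 0 < (X + C ((h : ℤ)) : ℤ[X]).leadingCoeff
    rw [(monic_X_add_C (h : ℤ)).leadingCoeff]
    exact one_pos
  · intro i j hij hassoc
    refine hij (Subtype.ext ?_)
    have heq : (X + C ((i : ℤ)) : ℤ[X]) = X + C ((j : ℤ)) :=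
      eq_of_monic_of_associated (monic_X_add_C _) (monic_X_add_C _) hassoc
    simpa using congrArg (fun g : ℤ[X] ↦ g.coeff 0) heq

/-- `∏_{p ≤ x} (1 - 1/p)^{-k}(1 - ω_{f_H}(p)/p) = ∏_{p ≤ x} (1 - ν_H(p)/p)(1 - 1/p)^{-k}`: the
Bateman–Horn partial products of the linear system are the partial products of the singular
series of `H`, since `ω_{f_H}(p) = ν_H(p)` (`polyRootCountMod_linear_eq_tupleResidueCount_holds`)
and `k = #H`. Bateman–Horn 1962, §3. -/
theorem batemanHornPartial_linear_eq_singularSeriesPartial (H : Finset ℤ) (x : ℕ) :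
    batemanHornPartial (fun h : H ↦ (X + C (h : ℤ) : ℤ[X])) x = singularSeriesPartial H x := by
  unfold batemanHornPartial singularSeriesPartial singularSeriesFactor
  refine prod_congr rfl fun p hp ↦ ?_
  rw [polyRootCountMod_linear_eq_tupleResidueCount_holds H (Nat.mem_primesLE.mp hp).2,
    Fintype.card_coe, mul_comm]

/-- `C(f_H) = 𝔖(H)`: the Bateman–Horn constant of the linear system is the Hardy–Littlewood
singular series (both are the ordered limit of the same partial products). Bateman–Horn 1962, §3. -/
theorem batemanHornConst_linear_eq_singularSeries (H : Finset ℤ) :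
    batemanHornConst (fun h : H ↦ (X + C (h : ℤ) : ℤ[X])) = singularSeries H := by
  have h : batemanHornPartial (fun h : H ↦ (X + C (h : ℤ) : ℤ[X])) = singularSeriesPartial H :=
    funext (batemanHornPartial_linear_eq_singularSeriesPartial H)
  unfold batemanHornConst singularSeries
  rw [h]

/-- Count comparison `P_{f_H}(x) = π_H(x) + #{n ∈ {0} : n + h is a positive prime ∀ h ∈ H}`:
the Bateman–Horn count runs over `0 ≤ n ≤ x` and `(X + h)(n) = n + h`, the tuple count over
`1 ≤ n ≤ x`. [folklore] -/
theorem polyPrimeCount_linear_eq (H : Finset ℤ) (x : ℕ) :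
    polyPrimeCount (fun h : H ↦ (X + C (h : ℤ) : ℤ[X])) x =
      primeTupleCount H x +
        #((range 1).filter fun n : ℕ ↦ ∀ h ∈ H, 0 < (n : ℤ) + h ∧ ((n : ℤ) + h).toNat.Prime) := by
  unfold polyPrimeCount primeTupleCount
  simp only [eval_add, eval_X, eval_C, Subtype.forall]
  have hsplit : range (x + 1) = Icc 1 x ∪ range 1 := by
    ext n
    simp only [mem_union, mem_range, mem_Icc]
    omega
  have hdisj : Disjoint (Icc 1 x) (range 1) := by
    rw [disjoint_left]
    intro n hn hn'
    rw [mem_Icc] at hn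
    rw [mem_range] at hn'
    omega
  rw [hsplit, filter_union, card_union_of_disjoint (disjoint_filter_filter hdisj)]

/-- If `u ~ g` and `g → +∞` then `u + c ~ g` for every constant `c`. [folklore] -/
theorem isEquivalent_add_const_of_tendsto_atTop {u g : ℕ → ℝ} (hug : u ~[atTop] g)
    (hg : Tendsto g atTop atTop) (c : ℝ) : (fun x ↦ u x + c) ~[atTop] g :=
  hug.add_isLittleO (isLittleO_const_left.2 (Or.inr (tendsto_norm_atTop_atTop.comp hg)))

/-- **The linear slice of Bateman–Horn is the prime `k`-tuples asymptotic.**  For an admissible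
tuple `H`, `BatemanHornAsymptotic (X + h)_{h ∈ H}` holds iff `π_H(x) ~ 𝔖(H) · x/(log x)^{#H}`:
the constants agree (`C(f_H) = 𝔖(H)`, `∏ deg = 1`, `k = #H`) and the counts differ by the
constant `n = 0` term, which is `o` of the main term because `𝔖(H) = C(f_H) > 0`
(`IsBatemanHornSystem.hasBatemanHornConst_holds`). Bateman–Horn 1962, §3. -/
theorem batemanHornAsymptotic_linear_iff {H : Finset ℤ} (hH : IsAdmissibleTuple H) :
    BatemanHornAsymptotic (fun h : H ↦ (X + C (h : ℤ) : ℤ[X])) ↔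
      (fun x : ℕ ↦ (primeTupleCount H x : ℝ)) ~[atTop]
        fun x : ℕ ↦ singularSeries H * x / Real.log x ^ H.card := by
  have hf : IsBatemanHornSystem (fun h : H ↦ (X + C (h : ℤ) : ℤ[X])) :=
    (isBatemanHornSystem_linear_iff H).mpr hH
  obtain ⟨hCf, hpos⟩ := IsBatemanHornSystem.hasBatemanHornConst_holds hf
  rw [batemanHornConst_linear_eq_singularSeries] at hCf hpos
  have hprod : ∏ i : H, (((X + C ((i : ℤ)) : ℤ[X])).natDegree : ℝ) = 1 := by
    simp only [natDegree_X_add_C, Nat.cast_one, prod_const_one]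
  have hcard : Fintype.card H = H.card := Fintype.card_coe H
  have hg : Tendsto (fun x : ℕ ↦ singularSeries H * x / Real.log x ^ H.card) atTop atTop := by
    simpa [mul_div_assoc] using (tendsto_natCast_div_log_pow_atTop H.card).const_mul_atTop hpos
  have hcount : ∀ x : ℕ, (polyPrimeCount (fun h : H ↦ (X + C (h : ℤ) : ℤ[X])) x : ℝ) =
      (primeTupleCount H x : ℝ) +
        (#((range 1).filter fun n : ℕ ↦ ∀ h ∈ H, 0 < (n : ℤ) + h ∧ ((n : ℤ) + h).toNat.Prime) : ℝ) :=
    fun x ↦ by exact_mod_cast polyPrimeCount_linear_eq H x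
  set c₀ : ℝ :=
    (#((range 1).filter fun n : ℕ ↦ ∀ h ∈ H, 0 < (n : ℤ) + h ∧ ((n : ℤ) + h).toNat.Prime) : ℝ)
    with hc₀
  constructor
  · rintro ⟨C', hC', hQ⟩
    have hCeq : C' = singularSeries H := tendsto_nhds_unique hC' hCf
    have hQ' : (fun x : ℕ ↦ (polyPrimeCount (fun h : H ↦ (X + C (h : ℤ) : ℤ[X])) x : ℝ)) ~[atTop]
        fun x : ℕ ↦ singularSeries H * x / Real.log x ^ H.card := by
      refine hQ.congr_right (Eventually.of_forall fun x ↦ ?_)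
      rw [hprod, div_one, hcard, hCeq]
    refine (isEquivalent_add_const_of_tendsto_atTop hQ' hg (-c₀)).congr_left
      (Eventually.of_forall fun x ↦ ?_)
    dsimp only
    rw [hcount]
    ring
  · intro hHL
    refine ⟨singularSeries H, hCf, ?_⟩
    refine ((isEquivalent_add_const_of_tendsto_atTop hHL hg c₀).congr_left
      (Eventually.of_forall fun x ↦ (hcount x).symm)).congr_right
        (Eventually.of_forall fun x ↦ ?_)
    rw [hprod, div_one, hcard]

/-- For an admissible `H`, the prime `k`-tuples conjecture alone already gives the conjunct's
instance `BatemanHornAsymptotic (X + h)_{h ∈ H}`. -/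
theorem batemanHornAsymptotic_linear_of_hardyLittlewoodTuples (hHL : HardyLittlewoodTuples)
    {H : Finset ℤ} (hH : IsAdmissibleTuple H) :
    BatemanHornAsymptotic (fun h : H ↦ (X + C (h : ℤ) : ℤ[X])) :=
  (batemanHornAsymptotic_linear_iff hH).mpr (hHL H hH)

/-- **`HardyLittlewoodTuples` is the monic-linear slice of the conjunct.**  The tree's prime
`k`-tuples conjecture (parity.S01) holds iff the Bateman–Horn asymptotic holds for every system
`(X + h)_{h ∈ H}` satisfying the Bateman–Horn hypotheses. Bateman–Horn 1962, §3;
Hardy–Littlewood 1923, Conjecture B / Theorem X 1. -/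
theorem hardyLittlewoodTuples_iff_batemanHorn_linear :
    HardyLittlewoodTuples ↔
      ∀ H : Finset ℤ, IsBatemanHornSystem (fun h : H ↦ (X + C (h : ℤ) : ℤ[X])) →
        BatemanHornAsymptotic (fun h : H ↦ (X + C (h : ℤ) : ℤ[X])) := by
  refine ⟨fun hHL H hf ↦ ?_, fun hBH H hH ↦ ?_⟩
  · exact batemanHornAsymptotic_linear_of_hardyLittlewoodTuples hHL
      ((isBatemanHornSystem_linear_iff H).mp hf)
  · exact (batemanHornAsymptotic_linear_iff hH).mp
      (hBH H ((isBatemanHornSystem_linear_iff H).mpr hH))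

/-- **The conjunct implies the prime `k`-tuples conjecture** (`x/(log x)^k` form): for every
admissible `H`, `π_H(x) ~ 𝔖(H) x/(log x)^{#H}`. Bateman–Horn 1962, §3 ("for linear polynomials
the conjecture reduces to that of Hardy and Littlewood"). -/
theorem hardyLittlewoodTuples_of_batemanHornConjecture (hBH : BatemanHornConjecture) :
    HardyLittlewoodTuples :=
  hardyLittlewoodTuples_iff_batemanHorn_linear.mpr fun H hf ↦
    (batemanHornConjecture_iff_fintype.mp hBH) (↥H) (fun h : H ↦ (X + C (h : ℤ) : ℤ[X])) hf

/-- **The conjunct implies Hardy–Littlewood's Theorem X 1 verbatim** (`Li_k` form,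
`HardyLittlewoodTuplesLi`), via the tree's `hardyLittlewoodTuples_iff_li_holds`. -/
theorem hardyLittlewoodTuplesLi_of_batemanHornConjecture (hBH : BatemanHornConjecture) :
    HardyLittlewoodTuplesLi :=
  hardyLittlewoodTuples_iff_li_holds.mp (hardyLittlewoodTuples_of_batemanHornConjecture hBH)

end LinearSlice

end Summit.Parity.BatemanHorn.Theorems
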